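import Literature.Probability.LatticeModels.SlitPlaneSeamMatching
import Literature.Probability.LatticeModels.KCObservableFlux
import HarnessLib

/-!
# Re-signing the spin fermion across its seam: the quadrant gauges

Topic `Literature/Probability/LatticeModels`. The signed Kadanoff–Ceva observable `kcObs`
(`IsingDisorderObservable.lean`) realises the spinor `F_{[Ω_δ,a]}` of Chelkak–Hongler–Izyurov 2015
(Prop. 2.4) as a SECTION: s-holomorphic off the seam of lower corners on the east half-row from the
source corner, with opposite projections across it (`IsingDisorderSeam.lean`). The regularity
theory (`KCObservableBulkBounds.lean`) is stated for the seam-free bulk; near the seam (but away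
from the source) one passes to the other local branch. This file provides the branch change: the
bond sign `seamChiS p₀` (`-1` on the bonds based in the quadrant south of the seam row and east of
the source plaquette `p₀`) jumps exactly across the seam and across the vertical ray going DOWN from
`p₀` (`seamChiS_jump_*`), so that `seamChiS · kcObs` is s-holomorphic at every corner off that ray
and off the source (`isSHolAt_seamGaugeS_*`), the seam included. (The mirror gauge for the ray
going up is analogous and not needed as long as balls south-east of the source are treated with
this one and lattice balls, being axis-parallel squares, cannot meet the seam and both rays
without containing the source.) The sign conventions enter only through their values
`hLowSign ∅ = -1` and `vLowSign ∅ cut x = ±1` according to the seam (`vLowSign_eq_of_source`),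
taken here as hypotheses on the sites involved. Everything is proved; no named fact.

## References

* D. Chelkak, C. Hongler, K. Izyurov, Ann. of Math. 181 (2015): Prop. 2.4, §3.3
  [ChelkakHonglerIzyurovAnnals2015].
-/

noncomputable section

namespace Literature.Probability.LatticeModels

open Complex SimpleGraph

/-- The south-east quadrant of the source plaquette `p₀`: sites on or below the row of `p₀` and
strictly east of it. [folklore] -/
def seamQuadS (p₀ x : Site 2) : Prop := x 1 ≤ p₀ 1 ∧ p₀ 0 + 1 ≤ x 0

/-- Membership in the quadrant is decidable. [folklore] -/
instance (p₀ x : Site 2) : Decidable (seamQuadS p₀ x) := by unfold seamQuadS; infer_instance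

/-- The site sign: `-1` on the quadrant. [folklore] -/
def seamSgnS (p₀ x : Site 2) : ℝ := if seamQuadS p₀ x then -1 else 1

/-- `seamSgnS = ±1`. [folklore] -/
theorem seamSgnS_cases (p₀ x : Site 2) : seamSgnS p₀ x = 1 ∨ seamSgnS p₀ x = -1 := by
  unfold seamSgnS; split_ifs <;> simp

open scoped Classical in
/-- **The quadrant gauge**: a bond carries the sign of its base site (left end of an east bond,
lower end of a north bond); `1` on non-bonds. [folklore] -/
def seamChiS (p₀ : Site 2) (e : MedialVertex) : ℝ :=
  if h : ∃ v : Site 2, e = s(v, v + cornerUnit 0) then seamSgnS p₀ h.choose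
  else if h' : ∃ x : Site 2, e = s(x, x + cornerUnit 1) then seamSgnS p₀ h'.choose else 1

/-- The gauge on an east bond. [folklore] -/
theorem seamChiS_east (p₀ v : Site 2) : seamChiS p₀ s(v, v + cornerUnit 0) = seamSgnS p₀ v := by
  classical
  have h : ∃ u : Site 2, s(v, v + cornerUnit 0) = s(u, u + cornerUnit 0) := ⟨v, rfl⟩
  rw [seamChiS, dif_pos h, eastBond_injective h.choose_spec.symm]

/-- The gauge on a north bond. [folklore] -/
theorem seamChiS_north (p₀ x : Site 2) : seamChiS p₀ s(x, x + cornerUnit 1) = seamSgnS p₀ x := by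
  classical
  have h : ¬ ∃ u : Site 2, s(x, x + cornerUnit 1) = s(u, u + cornerUnit 0) := fun ⟨u, hu⟩ => northBond_ne_eastBond x u hu
  have h' : ∃ u : Site 2, s(x, x + cornerUnit 1) = s(u, u + cornerUnit 1) := ⟨x, rfl⟩
  rw [seamChiS, dif_neg h, dif_pos h', northBond_injective h'.choose_spec.symm]

/-- The gauge on the two bonds of each corner type (`cSrc`, `cTgt`). [folklore] -/
theorem seamChiS_corner (p₀ y : Site 2) :
    (seamChiS p₀ (cSrc (y, 0)) = seamSgnS p₀ y ∧ seamChiS p₀ (cTgt (y, 0)) = seamSgnS p₀ y) ∧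
    (seamChiS p₀ (cSrc (y, 1)) = seamSgnS p₀ y ∧ seamChiS p₀ (cTgt (y, 1)) = seamSgnS p₀ (y + cornerUnit 2)) ∧
    (seamChiS p₀ (cSrc (y, 2)) = seamSgnS p₀ (y + cornerUnit 2) ∧ seamChiS p₀ (cTgt (y, 2)) = seamSgnS p₀ (y + cornerUnit 3)) ∧
    (seamChiS p₀ (cSrc (y, 3)) = seamSgnS p₀ (y + cornerUnit 3) ∧ seamChiS p₀ (cTgt (y, 3)) = seamSgnS p₀ y) := by
  simp only [cSrc, cTgt, show (0 : Fin 4) + 1 = 1 from rfl, show (1 : Fin 4) + 1 = 2 from rfl, show (2 : Fin 4) + 1 = 3 from rfl,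
    show (3 : Fin 4) + 1 = 0 from rfl, westBond_eq, southBond_eq, seamChiS_east, seamChiS_north]
  simp

/-- The gauged section. [cite: ChelkakHonglerIzyurovAnnals2015, Prop. 2.4] -/
def seamGaugeS (F : MedialVertex → ℂ) (p₀ : Site 2) (e : MedialVertex) : ℂ := (seamChiS p₀ e : ℂ) * F e

section Table

variable (G₂ : SimpleGraph (Site 2)) [G₂.LocallyFinite]
variable {Λ : Finset (Site 2)} {η : SpinConfig (Site 2)} {cut : Site 2 → Finset (Sym2 (Site 2))}

/-- **`(y, NE)`**: no jump, `kcObs` s-holomorphic — the gauged section is s-holomorphic. [cite: ChelkakHonglerIzyurovAnnals2015, Prop. 2.4] -/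
theorem isSHolAt_seamGaugeS_zero (hG : ∀ v ∈ Λ, ∀ k : Fin 4, G₂.Adj v (v + cornerUnit k)) (hle : G₂ ≤ zdGraph 2) (p₀ : Site 2)
    {B : Finset (Site 2)} {y : Site 2} (hT : cut (faceAt y 1) ⊆ edgesTouching G₂ Λ) (he : s(y, y + cornerUnit 1) ∈ edgesTouching G₂ Λ)
    (hstep : KCGaugeEquiv G₂ Λ (symmDiff (cut (faceAt y 1)) {s(y, y + cornerUnit 1)}) (cut (faceAt y 0))) :
    IsSHolAt (seamGaugeS (kcObs G₂ Λ η B cut) p₀) (y, 0) := by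
  obtain ⟨⟨h1, h2⟩, -, -, -⟩ := seamChiS_corner p₀ y
  have hχ : seamChiS p₀ (cSrc (y, 0)) = 1 ∨ seamChiS p₀ (cSrc (y, 0)) = -1 := by rw [h1]; exact seamSgnS_cases p₀ y
  exact (isSHolAt_sign_mul_iff (F := kcObs G₂ Λ η B cut) hχ (by rw [h1, h2])).2 (isSHolAt_kcObs_zero G₂ hG hle hT he hstep)

/-- **`(y, NW)` off the down-ray** (`¬(y 0 = p₀ 0 + 1 ∧ y 1 ≤ p₀ 1)`): no jump. [cite: ChelkakHonglerIzyurovAnnals2015, Prop. 2.4] -/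
theorem isSHolAt_seamGaugeS_one (hG : ∀ v ∈ Λ, ∀ k : Fin 4, G₂.Adj v (v + cornerUnit k)) (hle : G₂ ≤ zdGraph 2) (p₀ : Site 2)
    {B : Finset (Site 2)} {y : Site 2} (hT : cut (faceAt y 1) ⊆ edgesTouching G₂ Λ)
    (he : s(y + cornerUnit 2, y + cornerUnit 2 + cornerUnit 0) ∈ edgesTouching G₂ Λ)
    (hstep : KCGaugeEquiv G₂ Λ (symmDiff (cut (faceAt y 1)) {s(y + cornerUnit 2, y + cornerUnit 2 + cornerUnit 0)})
      (cut (faceAt y 2)))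
    (hray : ¬(y 0 = p₀ 0 + 1 ∧ y 1 ≤ p₀ 1)) :
    IsSHolAt (seamGaugeS (kcObs G₂ Λ η B cut) p₀) (y, 1) := by
  obtain ⟨-, ⟨h1, h2⟩, -, -⟩ := seamChiS_corner p₀ y
  have hχ : seamChiS p₀ (cSrc (y, 1)) = 1 ∨ seamChiS p₀ (cSrc (y, 1)) = -1 := by rw [h1]; exact seamSgnS_cases p₀ y
  have heq : seamChiS p₀ (cTgt (y, 1)) = seamChiS p₀ (cSrc (y, 1)) := by
    rw [h1, h2, seamSgnS, seamSgnS]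
    have hw0 : (y + cornerUnit 2) 0 = y 0 - 1 := by simp [cornerUnit]; ring
    have hw1 : (y + cornerUnit 2) 1 = y 1 := by simp [cornerUnit]
    by_cases ha : seamQuadS p₀ y
    · rw [if_pos ha, if_pos (show seamQuadS p₀ (y + cornerUnit 2) by unfold seamQuadS at ha ⊢; rw [hw0, hw1]; omega)]
    · rw [if_neg ha, if_neg (show ¬seamQuadS p₀ (y + cornerUnit 2) by unfold seamQuadS at ha ⊢; rw [hw0, hw1]; omega)]
  exact (isSHolAt_sign_mul_iff (F := kcObs G₂ Λ η B cut) hχ heq).2 (isSHolAt_kcObs_one G₂ hG hle hT he hstep)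

/-- **`(y, SW)` off the down-ray and off the source corner**, with the sign conventions of the
one-point observable (`hLowSign = -1`, `vLowSign = +1` exactly on the seam): s-holomorphic — by
`isSHolAt_kcObs_two` off the seam (no jump) and by the seam relation plus the jump on it. [cite: ChelkakHonglerIzyurovAnnals2015, Prop. 2.4] -/
theorem isSHolAt_seamGaugeS_two (hG : ∀ v ∈ Λ, ∀ k : Fin 4, G₂.Adj v (v + cornerUnit k)) (hle : G₂ ≤ zdGraph 2) (p₀ : Site 2)
    {B : Finset (Site 2)} {y : Site 2} (hT : cut (faceAt y 2) ⊆ edgesTouching G₂ Λ)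
    (he : s(y + cornerUnit 3, y + cornerUnit 3 + cornerUnit 1) ∈ edgesTouching G₂ Λ)
    (hstep : KCGaugeEquiv G₂ Λ (symmDiff (cut (faceAt y 2)) {s(y + cornerUnit 3, y + cornerUnit 3 + cornerUnit 1)})
      (cut (faceAt y 3)))
    (hH : hLowSign B (y + cornerUnit 2) = -1)
    (hV : vLowSign B cut (y + cornerUnit 3) = if (y 1 = p₀ 1 + 1 ∧ p₀ 0 + 1 ≤ y 0) then 1 else -1)
    (hray : ¬(y 0 = p₀ 0 + 1 ∧ y 1 ≤ p₀ 1 + 1)) :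
    IsSHolAt (seamGaugeS (kcObs G₂ Λ η B cut) p₀) (y, 2) := by
  obtain ⟨-, -, ⟨h1, h2⟩, -⟩ := seamChiS_corner p₀ y
  have hχ : seamChiS p₀ (cSrc (y, 2)) = 1 ∨ seamChiS p₀ (cSrc (y, 2)) = -1 := by rw [h1]; exact seamSgnS_cases p₀ _
  have hw0 : (y + cornerUnit 2) 0 = y 0 - 1 := by simp [cornerUnit]; ring
  have hw1 : (y + cornerUnit 2) 1 = y 1 := by simp [cornerUnit]
  have hs0 : (y + cornerUnit 3) 0 = y 0 := by simp [cornerUnit]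
  have hs1 : (y + cornerUnit 3) 1 = y 1 - 1 := by simp [cornerUnit]; ring
  by_cases hseam : y 1 = p₀ 1 + 1 ∧ p₀ 0 + 1 ≤ y 0
  · -- on the seam: opposite signs, anti relation
    rw [if_pos hseam] at hV
    have hop : seamChiS p₀ (cTgt (y, 2)) = -seamChiS p₀ (cSrc (y, 2)) := by
      rw [h1, h2, seamSgnS, seamSgnS, if_neg (show ¬seamQuadS p₀ (y + cornerUnit 2) by unfold seamQuadS; rw [hw0, hw1]; omega),
        if_pos (show seamQuadS p₀ (y + cornerUnit 3) by unfold seamQuadS; rw [hs0, hs1]; omega)]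
    have hsign : hLowSign B (y + cornerUnit 2) = -vLowSign B cut (y + cornerUnit 3) := by rw [hH, hV]
    exact ((isSHolAt_sign_mul_iff_anti (F := kcObs G₂ Λ η B cut) hχ hop).1).2 (isAntiAt_kcObs_two G₂ hG hle hT he hstep hsign)
  · -- off the seam: equal signs, honest relation
    rw [if_neg hseam] at hV
    have heq : seamChiS p₀ (cTgt (y, 2)) = seamChiS p₀ (cSrc (y, 2)) := by
      rw [h1, h2, seamSgnS, seamSgnS]
      by_cases ha : seamQuadS p₀ (y + cornerUnit 2)
      · rw [if_pos ha, if_pos (show seamQuadS p₀ (y + cornerUnit 3) by unfold seamQuadS at ha ⊢; rw [hw0, hw1] at ha; rw [hs0, hs1]; omega)]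
      · rw [if_neg ha, if_neg (show ¬seamQuadS p₀ (y + cornerUnit 3) by
          unfold seamQuadS at ha ⊢; rw [hw0, hw1] at ha; rw [hs0, hs1]; omega)]
    have hsign : hLowSign B (y + cornerUnit 2) = vLowSign B cut (y + cornerUnit 3) := by rw [hH, hV]
    exact (isSHolAt_sign_mul_iff (F := kcObs G₂ Λ η B cut) hχ heq).2 (isSHolAt_kcObs_two G₂ hG hle hT he hstep hsign)

/-- **`(y, SE)`** with the sign conventions of the one-point observable: s-holomorphic everywhere
(honest off the seam, jump + anti on it). [cite: ChelkakHonglerIzyurovAnnals2015, Prop. 2.4] -/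
theorem isSHolAt_seamGaugeS_three (hG : ∀ v ∈ Λ, ∀ k : Fin 4, G₂.Adj v (v + cornerUnit k)) (hle : G₂ ≤ zdGraph 2) (p₀ : Site 2)
    {B : Finset (Site 2)} {y : Site 2} (hT : cut (faceAt y 0) ⊆ edgesTouching G₂ Λ) (he : s(y, y + cornerUnit 0) ∈ edgesTouching G₂ Λ)
    (hstep : KCGaugeEquiv G₂ Λ (symmDiff (cut (faceAt y 0)) {s(y, y + cornerUnit 0)}) (cut (faceAt y 3)))
    (hH : hLowSign B y = -1)
    (hV : vLowSign B cut (y + cornerUnit 3) = if (y 1 = p₀ 1 + 1 ∧ p₀ 0 + 1 ≤ y 0) then 1 else -1) :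
    IsSHolAt (seamGaugeS (kcObs G₂ Λ η B cut) p₀) (y, 3) := by
  obtain ⟨-, -, -, ⟨h1, h2⟩⟩ := seamChiS_corner p₀ y
  have hχ : seamChiS p₀ (cSrc (y, 3)) = 1 ∨ seamChiS p₀ (cSrc (y, 3)) = -1 := by rw [h1]; exact seamSgnS_cases p₀ _
  have hs0 : (y + cornerUnit 3) 0 = y 0 := by simp [cornerUnit]
  have hs1 : (y + cornerUnit 3) 1 = y 1 - 1 := by simp [cornerUnit]; ring
  by_cases hseam : y 1 = p₀ 1 + 1 ∧ p₀ 0 + 1 ≤ y 0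
  · rw [if_pos hseam] at hV
    have hop : seamChiS p₀ (cTgt (y, 3)) = -seamChiS p₀ (cSrc (y, 3)) := by
      rw [h1, h2, seamSgnS, seamSgnS, if_neg (show ¬seamQuadS p₀ y by unfold seamQuadS; omega),
        if_pos (show seamQuadS p₀ (y + cornerUnit 3) by unfold seamQuadS; rw [hs0, hs1]; omega)]
      norm_num
    have hsign : vLowSign B cut (y + cornerUnit 3) = -hLowSign B y := by rw [hH, hV]; norm_num
    exact ((isSHolAt_sign_mul_iff_anti (F := kcObs G₂ Λ η B cut) hχ hop).1).2 (isAntiAt_kcObs_three G₂ hG hle hT he hstep hsign)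
  · rw [if_neg hseam] at hV
    have heq : seamChiS p₀ (cTgt (y, 3)) = seamChiS p₀ (cSrc (y, 3)) := by
      rw [h1, h2, seamSgnS, seamSgnS]
      by_cases ha : seamQuadS p₀ (y + cornerUnit 3)
      · rw [if_pos ha, if_pos (show seamQuadS p₀ y by unfold seamQuadS at ha ⊢; rw [hs0, hs1] at ha; omega)]
      · rw [if_neg ha, if_neg (show ¬seamQuadS p₀ y by unfold seamQuadS at ha ⊢; rw [hs0, hs1] at ha; omega)]
    have hsign : vLowSign B cut (y + cornerUnit 3) = hLowSign B y := by rw [hH, hV]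
    exact (isSHolAt_sign_mul_iff (F := kcObs G₂ Λ η B cut) hχ heq).2 (isSHolAt_kcObs_three G₂ hG hle hT he hstep hsign)

end Table

/-- For the one-point observable (`B = ∅`) the horizontal lower sign is `-1` everywhere. [folklore] -/
theorem hLowSign_empty (v : Site 2) : hLowSign ∅ v = -1 := by
  simp [hLowSign, rowSign, rayCountB]

end Literature.Probability.LatticeModels
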